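import Literature.Combinatorics.Optimization.StableSetPolytopePsdMinimal
import Literature.Combinatorics.Optimization.PatternMatrixRankUpperBounds
import Literature.Barriers.PneNP.ExtendedFormulationYannakakisConverse
import HarnessLib

/-!
# Yannakakis 1991, §5: the clique-versus-stable-set protocol (Lemma 1) and LPs of size
# `n^{O(log n)}` for the stable set polytopes of perfect graphs (Theorem 5) — PROVED

Source: M. Yannakakis, *Expressing combinatorial optimization problems by linear programs*,
J. Comput. System Sci. 43 (1991) 441–466 [Yannakakis1991] (held text `paper:doi-10-1145-62212-62232`,
journal pagination), §5 "Vertex packing polytopes", pp. 460–463.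

The printed text (verbatim). p. 461: "Another set of valid constraints for VP(G) follows from the fact
that an independent set can contain at most one node from a clique: (3) `Σ_{i∈K} x_i ≤ 1` for every
clique `K` of the graph. Together with the nonnegativity constraints `x_i ≥ 0`, these constraints are
sufficient to describe the vertex packing polytope of perfect graphs." … "The slack matrix for the
constraints (3) is 0-1, has one row for every clique and one column for every independent set, and
the entry corresponding to a clique `K` and an independent set `I` is `1` if `K ∩ I = ∅`, and `0`
otherwise." … "For a graph `G`, let `Q` be the predicate which is true of a clique `K` and independent
set `I` if `K` and `I` are disjoint and false otherwise. … an unambiguous protocol of complexity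
`log d` for the predicate `Q̄` of a perfect graph `G` (and of course, a deterministic protocol, as
well) gives a linear program expressing VP(G) with `O(d)` variables and constraints". p. 462: "How
about the rest of the perfect graphs? The best we can do is `n^{O(log n)}` using a result from
communication complexity. LEMMA 1. If the unambiguous communication complexity of a predicate is
`g`, then its deterministic complexity is at most `O(g²)`." Its proof is the protocol (p. 462–463):
"In each stage, the clique side sends a node, say `u`, of the clique `K` that is adjacent to at most
half of the nodes of the current graph or notifies the other side that it has no such node. In the
first case, the side with the independent set `I` communicates whether (i) `u ∈ I` … If (i) occurs
then `K ∩ I ≠ ∅` …; if neither occurs then the nodes that are not adjacent to `u` are removed from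
the graph (they cannot be in the clique, and therefore, neither in `K ∩ I`), and the stage finishes.
In the second case (all nodes of `K` are adjacent to more than half of the nodes), the independent
side sends a node `v` of `I` that is adjacent to at least half of the nodes of the current graph or
communicates that it has no such node. In the latter case, `K ∩ I = ∅` because of the degrees, and
the protocol finishes. Otherwise … the nodes adjacent to `v` are removed from the graph (they cannot
be in `I`) and the stage finishes. Since every stage removes half of the nodes, there are at most `g`
stages, and the communication per stage is obviously `O(g)`." p. 463: "As the numbers involved are
small (0-1), it follows from the lemma and Theorem 3 that: THEOREM 5. The vertex packing polytopes of
perfect graphs can be expressed by LP's of size `n^{O(log n)}`."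

## What is proved here (no new notion, no named fact)

The protocol of Lemma 1 for the predicate `Q` of a graph `G` on `Fin n` is formalised directly as
the PARTITION INTO MONOCHROMATIC `1`-RECTANGLES it induces (p. 461: the number `d` of disjoint
monochromatic rectangles covering the `1`s "is also the smallest number such that CM(Π) can be
written as the product (real multiplication) of two 0-1 matrices with `d` as the intermediate
dimension [MS]"), which is all that Theorem 5 consumes:

* `CliqueStableSet.disjEntry W K S = 𝟙[K ∩ S ∩ W = ∅]` — the predicate `Q` on "the current graph",
  the window `W`; one stage of the protocol is the identity `CliqueStableSet.disjEntry_stage`: with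
  `L` = the nodes of `W` adjacent to fewer than half of the nodes of `W` (`lowSet`), `H = W ∖ L`
  (`highSet`), for every clique `K` and stable set `S`
  `𝟙[K∩S∩W = ∅] = Σ_{v∈L} 𝟙[min(K∩L) = v]·𝟙[v ∉ S]·𝟙[K∩S∩(W∩N(v)) = ∅]`
  `              + Σ_{w∈H} 𝟙[K∩L = ∅, w ∉ K]·𝟙[min(S∩H) = w]·𝟙[K∩S∩(W∖N[w]) = ∅] + 𝟙[K∩L = ∅]·𝟙[S∩H = ∅]`
  (the clique side announces its least low-degree node, else the stable side its least high-degree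
  node, else the degrees force disjointness); both new windows have `≤ (|W|−1)/2` nodes
  (`card_nbrWindow_le`, `card_coNbrWindow_le`);
* `CliqueStableSet.exists_rectanglePartition` — by strong induction on `|W|`: `𝟙[K∩S∩W = ∅]` is a
  sum of at most `(|W|+1)^{⌊log₂(|W|+1)⌋+1}` products `a_i(K)·b_i(S)` of `0/1`-valued functions, the
  recurrence `d(m) ≤ m·d(⌊(m−1)/2⌋) + 1` being `CliqueStableSet.rectBound_stage`;
* `Yannakakis1991_lemma1_cliqueStableSet` — the case `W = V`: the communication matrix of `Q` on
  cliques × stable sets is a sum of `≤ (n+1)^{⌊log₂(n+1)⌋+1}` rectangles; equivalently (p. 461) the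
  slack matrix `1 − |K ∩ S|` of the clique constraints (3) (`cliqueSlack_eq_disjEntry`) has a
  nonnegative factorisation of that size (`hasNonnegFactorization_cliqueSlack`);
* `Yannakakis1991_thm5` — **Theorem 5**, with perfection typed — as in the tree's
  `StableSetPolytopePsdMinimal.lean` (GRT 2013, Thm 4.12) — by its polyhedral characterisation
  `stabPolytope G = cliqueConstraintPolytope G` ("constraints (3) together with the nonnegativity
  constraints describe VP(G)", p. 461): `STAB(G)` then has an extended formulation, in the tree's
  slack-form currency `HasEFOfSize` (FMPTW), of size `(n+1)^{⌊log₂(n+1)⌋+2}`, obtained from the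
  tree's converse half of the factorisation theorem (Thm 3),
  `hasEFOfSize_of_complete_nonneg_factorization`, applied to the complete family
  {clique rows (3)} ∪ {−x_i ≤ 0}; `Yannakakis1991_thm5_rpow` restates the size as `≤ n^{C·log n}`
  (`C = 8/log 2`, `n ≥ 2`).

Deviations from print (bookkeeping only): (i) the window shrinks to `W ∩ N(u)` resp. `W ∖ N[v]` under
the degree thresholds `2·deg_W(u) < |W|` (clique side) and `2·deg_W(v) ≥ |W|` (stable side), so both
new windows have at most `(|W|−1)/2` nodes and the count is the clean `(m+1)^{⌊log₂(m+1)⌋+1}`;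
(ii) the announced node is the LEAST admissible one (any deterministic choice rule gives a
partition); (iii) the protocol is recorded as its rectangle partition, not as a protocol tree; the
general Lemma 1 (an arbitrary predicate of unambiguous complexity `g` reduces to `Q` on the graph of
its `2^g` rectangles) is the appended last section (`Yannakakis1991_lemma1`, same currency: a partition
of the `1`s into `d` rectangles yields a partition of the `0`s into `≤ (d+1)^{⌊log₂(d+1)⌋+1}`).

Context in the tree: `StableSetPolytopePsdMinimal.lean` proves the SDP counterpart under the same
hypothesis (GRT 2013: `STAB(G)` has a psd lift of size `n + 1` and no smaller one). Whether the
vertex packing polytopes of perfect graphs have POLYNOMIAL-size LPs is left open in the source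
(p. 462: "The best we can do is `n^{O(log n)}`").
-/

noncomputable section

open Finset

namespace Literature.Combinatorics.Optimization

open Literature.Barriers.PneNP (HasEFOfSize hasEFOfSize_of_complete_nonneg_factorization)

variable {n : ℕ}

namespace CliqueStableSet

/-! ### The windowed predicate and one stage of the protocol -/

/-- The predicate `Q` restricted to the current graph `W` ("the nodes … are removed from the graph"):
`disjEntry W K S = 1` if `K ∩ S ∩ W = ∅` and `0` otherwise. [cite: Yannakakis1991, §5 p. 461 (predicate Q) and p. 462 (proof of Lemma 1)] -/
def disjEntry (W K S : Finset (Fin n)) : ℝ := if K ∩ S ∩ W = ∅ then 1 else 0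

/-- `disjEntry` is `0/1`-valued. [cite: Yannakakis1991, §5 p. 461 ("The slack matrix for the constaints (3) is 0-1")] -/
theorem disjEntry_zero_or_one (W K S : Finset (Fin n)) : disjEntry W K S = 0 ∨ disjEntry W K S = 1 := by
  unfold disjEntry; split_ifs <;> simp

variable (G : SimpleGraph (Fin n)) [DecidableRel G.Adj]

/-- The window after the clique side announces `v`: the nodes of `W` adjacent to `v` ("the nodes that
are not adjacent to `u` are removed from the graph"). [cite: Yannakakis1991, §5, proof of Lemma 1 (p. 462)] -/
def nbrWindow (W : Finset (Fin n)) (v : Fin n) : Finset (Fin n) := W.filter fun x => G.Adj v x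

/-- The window after the stable side announces `w`: the nodes of `W` other than `w` not adjacent to `w`
("the nodes adjacent to `v` are removed from the graph (they cannot be in `I`)"; `w ∉ K` is removed too).
[cite: Yannakakis1991, §5, proof of Lemma 1 (p. 463)] -/
def coNbrWindow (W : Finset (Fin n)) (w : Fin n) : Finset (Fin n) :=
  (W.filter fun x => ¬ G.Adj w x).erase w

/-- The nodes of `W` "adjacent to at most half of the nodes of the current graph", here with the strict
threshold `2·deg_W(v) < |W|` (the clique side's candidates). [cite: Yannakakis1991, §5, proof of Lemma 1 (p. 462)] -/
def lowSet (W : Finset (Fin n)) : Finset (Fin n) := W.filter fun v => 2 * (nbrWindow G W v).card < W.card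

/-- The nodes of `W` "adjacent to at least half of the nodes of the current graph", `|W| ≤ 2·deg_W(v)`
(the stable side's candidates). [cite: Yannakakis1991, §5, proof of Lemma 1 (p. 462–463)] -/
def highSet (W : Finset (Fin n)) : Finset (Fin n) := W.filter fun v => W.card ≤ 2 * (nbrWindow G W v).card

variable {G}

/-- The low nodes lie in the window. [cite: Yannakakis1991, §5, proof of Lemma 1 (p. 462)] -/
theorem lowSet_subset (W : Finset (Fin n)) : lowSet G W ⊆ W := filter_subset _ _

/-- The high nodes lie in the window. [cite: Yannakakis1991, §5, proof of Lemma 1 (p. 462–463)] -/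
theorem highSet_subset (W : Finset (Fin n)) : highSet G W ⊆ W := filter_subset _ _

/-- Every node of the window is low or high. [cite: Yannakakis1991, §5, proof of Lemma 1 (p. 462–463)] -/
theorem mem_lowSet_or_mem_highSet {W : Finset (Fin n)} {v : Fin n} (hv : v ∈ W) :
    v ∈ lowSet G W ∨ v ∈ highSet G W := by
  by_cases h : 2 * (nbrWindow G W v).card < W.card
  · exact Or.inl (mem_filter.2 ⟨hv, h⟩)
  · exact Or.inr (mem_filter.2 ⟨hv, not_lt.1 h⟩)

/-- No node is both low and high. [cite: Yannakakis1991, §5, proof of Lemma 1 (p. 462–463)] -/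
theorem disjoint_lowSet_highSet (W : Finset (Fin n)) : Disjoint (lowSet G W) (highSet G W) := by
  rw [Finset.disjoint_left]
  intro v hl hh
  have h1 := (mem_filter.1 hl).2
  have h2 := (mem_filter.1 hh).2
  omega

/-- "Since every stage removes half of the nodes": the clique side's new window has at most
`(|W| − 1)/2` nodes. [cite: Yannakakis1991, §5, proof of Lemma 1 (p. 463)] -/
theorem card_nbrWindow_le {W : Finset (Fin n)} {v : Fin n} (hv : v ∈ lowSet G W) :
    (nbrWindow G W v).card ≤ (W.card - 1) / 2 := by
  have := (mem_filter.1 hv).2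
  omega

/-- "Since every stage removes half of the nodes": the stable side's new window has at most
`(|W| − 1)/2` nodes. [cite: Yannakakis1991, §5, proof of Lemma 1 (p. 463)] -/
theorem card_coNbrWindow_le {W : Finset (Fin n)} {w : Fin n} (hw : w ∈ highSet G W) :
    (coNbrWindow G W w).card ≤ (W.card - 1) / 2 := by
  obtain ⟨hwW, hdeg⟩ := mem_filter.1 hw
  have hmem : w ∈ W.filter fun x => ¬ G.Adj w x := mem_filter.2 ⟨hwW, G.irrefl⟩
  have hcard : (coNbrWindow G W w).card = (W.filter fun x => ¬ G.Adj w x).card - 1 :=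
    card_erase_of_mem hmem
  have hsplit := Finset.card_filter_add_card_filter_not (s := W) (fun x => G.Adj w x)
  have hpos : 0 < (W.filter fun x => ¬ G.Adj w x).card := card_pos.2 ⟨w, hmem⟩
  unfold nbrWindow at hdeg
  rw [hcard]
  omega

/-- Clique side, case "neither occurs": if the announced clique node `v` is not in `S`, only nodes
adjacent to `v` can lie in `K ∩ S` ("they cannot be in the clique, and therefore, neither in `K ∩ I`").
[cite: Yannakakis1991, §5, proof of Lemma 1 (p. 462)] -/
theorem inter_eq_inter_nbrWindow {W K S : Finset (Fin n)} (hK : G.IsClique (K : Set (Fin n)))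
    {v : Fin n} (hvK : v ∈ K) (hvS : v ∉ S) : K ∩ S ∩ W = K ∩ S ∩ nbrWindow G W v := by
  ext x
  simp only [mem_inter, nbrWindow, mem_filter]
  constructor
  · rintro ⟨⟨hxK, hxS⟩, hxW⟩
    have hne : v ≠ x := fun h => hvS (h ▸ hxS)
    exact ⟨⟨hxK, hxS⟩, hxW, hK (mem_coe.2 hvK) (mem_coe.2 hxK) hne⟩
  · rintro ⟨h1, h2, -⟩
    exact ⟨h1, h2⟩

/-- Stable side, case "otherwise": if the announced stable node `w` is not in `K`, only nodes other
than `w` and not adjacent to `w` can lie in `K ∩ S` ("they cannot be in `I`").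
[cite: Yannakakis1991, §5, proof of Lemma 1 (p. 463)] -/
theorem inter_eq_inter_coNbrWindow {W K S : Finset (Fin n)} (hS : ∀ i ∈ S, ∀ j ∈ S, ¬ G.Adj i j)
    {w : Fin n} (hwS : w ∈ S) (hwK : w ∉ K) : K ∩ S ∩ W = K ∩ S ∩ coNbrWindow G W w := by
  ext x
  simp only [mem_inter, coNbrWindow, mem_erase, mem_filter]
  constructor
  · rintro ⟨⟨hxK, hxS⟩, hxW⟩
    have hne : x ≠ w := fun h => hwK (h ▸ hxK)
    exact ⟨⟨hxK, hxS⟩, hne, hxW, hS w hwS x hxS⟩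
  · rintro ⟨h1, -, h2, -⟩
    exact ⟨h1, h2⟩

/-- "In the latter case, `K ∩ I = ∅` because of the degrees": if no clique node is low and no stable
node is high, the clique and the stable set do not meet inside the window.
[cite: Yannakakis1991, §5, proof of Lemma 1 (p. 463)] -/
theorem inter_eq_empty_of_degrees {W K S : Finset (Fin n)} (hKL : K ∩ lowSet G W = ∅)
    (hSH : S ∩ highSet G W = ∅) : K ∩ S ∩ W = ∅ := by
  refine eq_empty_iff_forall_notMem.2 fun x hx => ?_
  obtain ⟨⟨hxK, hxS⟩, hxW⟩ : (x ∈ K ∧ x ∈ S) ∧ x ∈ W := by simpa only [mem_inter] using hx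
  rcases mem_lowSet_or_mem_highSet (G := G) hxW with h | h
  · exact notMem_empty x (hKL ▸ mem_inter.2 ⟨hxK, h⟩)
  · exact notMem_empty x (hSH ▸ mem_inter.2 ⟨hxS, h⟩)

/-- Summing the indicator "`v` is the least element of `T`" against `f` over a set `A ⊇ T` picks out
`f (min T)` (the announced node is a deterministic function of the announcing side's set). [folklore] -/
private theorem sum_ite_min_mul {A T : Finset (Fin n)} (hT : T ⊆ A) (f : Fin n → ℝ) :
    ∑ v ∈ A, (if T.min = (v : WithTop (Fin n)) then (1 : ℝ) else 0) * f v =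
      if h : T.Nonempty then f (T.min' h) else 0 := by
  split_ifs with h
  · rw [Finset.sum_eq_single_of_mem (T.min' h) (hT (Finset.min'_mem T h))]
    · rw [if_pos (Finset.coe_min' h).symm, one_mul]
    · intro v _ hv
      rw [if_neg, zero_mul]
      intro hmin
      rw [← Finset.coe_min' h, WithTop.coe_eq_coe] at hmin
      exact hv hmin.symm
  · rw [Finset.not_nonempty_iff_eq_empty.1 h]
    refine Finset.sum_eq_zero fun v _ => ?_
    rw [Finset.min_empty, if_neg (fun h' => WithTop.top_ne_coe h'), zero_mul]

/-- **One stage of the protocol of Lemma 1, as an identity of `0/1` matrices** (see the module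
docstring): for a clique `K` and a stable set `S`, the windowed predicate `𝟙[K ∩ S ∩ W = ∅]` splits over
the clique side's announcements `v ∈ L` (least low-degree node of `K`; continue on `W ∩ N(v)` unless
`v ∈ S`), the stable side's announcements `w ∈ H` (no low node in `K`; least high-degree node of `S`;
continue on `W ∖ N[w]` unless `w ∈ K`) and termination (`K ∩ L = ∅ = S ∩ H`: disjoint by degrees), each
summand being a product of a function of `K` and a function of `S` (a rectangle).
[cite: Yannakakis1991, §5, Lemma 1 and its proof (p. 462–463)] -/
theorem disjEntry_stage (W K S : Finset (Fin n)) (hK : G.IsClique (K : Set (Fin n)))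
    (hS : ∀ i ∈ S, ∀ j ∈ S, ¬ G.Adj i j) :
    disjEntry W K S =
      (∑ v ∈ lowSet G W,
          (if (K ∩ lowSet G W).min = (v : WithTop (Fin n)) then (1 : ℝ) else 0) *
            (if v ∈ S then (0 : ℝ) else 1) * disjEntry (nbrWindow G W v) K S) +
      (∑ w ∈ highSet G W,
          (if K ∩ lowSet G W = ∅ ∧ w ∉ K then (1 : ℝ) else 0) *
            (if (S ∩ highSet G W).min = (w : WithTop (Fin n)) then (1 : ℝ) else 0) *
              disjEntry (coNbrWindow G W w) K S) +
      (if K ∩ lowSet G W = ∅ then (1 : ℝ) else 0) * (if S ∩ highSet G W = ∅ then (1 : ℝ) else 0) := by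
  set L := lowSet G W with hL
  set H := highSet G W with hH
  -- both sums pick out the least admissible node
  have hsum1 : ∑ v ∈ L, (if (K ∩ L).min = (v : WithTop (Fin n)) then (1 : ℝ) else 0) *
        (if v ∈ S then (0 : ℝ) else 1) * disjEntry (nbrWindow G W v) K S =
      if h : (K ∩ L).Nonempty then
        (if (K ∩ L).min' h ∈ S then (0 : ℝ) else 1) * disjEntry (nbrWindow G W ((K ∩ L).min' h)) K S
      else 0 := by
    rw [← sum_ite_min_mul inter_subset_right
      (fun v => (if v ∈ S then (0 : ℝ) else 1) * disjEntry (nbrWindow G W v) K S)]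
    exact Finset.sum_congr rfl fun v _ => by ring
  have hsum2 : ∑ w ∈ H, (if K ∩ L = ∅ ∧ w ∉ K then (1 : ℝ) else 0) *
        (if (S ∩ H).min = (w : WithTop (Fin n)) then (1 : ℝ) else 0) * disjEntry (coNbrWindow G W w) K S =
      if h : (S ∩ H).Nonempty then
        (if K ∩ L = ∅ ∧ (S ∩ H).min' h ∉ K then (1 : ℝ) else 0) *
          disjEntry (coNbrWindow G W ((S ∩ H).min' h)) K S
      else 0 := by
    rw [← sum_ite_min_mul inter_subset_right
      (fun w => (if K ∩ L = ∅ ∧ w ∉ K then (1 : ℝ) else 0) * disjEntry (coNbrWindow G W w) K S)]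
    exact Finset.sum_congr rfl fun w _ => by ring
  rw [hsum1, hsum2]
  by_cases hKL : (K ∩ L).Nonempty
  · -- the clique side announces `v₀ = min (K ∩ L)`
    have hKL' : K ∩ L ≠ ∅ := nonempty_iff_ne_empty.1 hKL
    rw [dif_pos hKL, if_neg hKL', zero_mul, add_zero]
    have h2 : (if h : (S ∩ H).Nonempty then
        (if K ∩ L = ∅ ∧ (S ∩ H).min' h ∉ K then (1 : ℝ) else 0) *
          disjEntry (coNbrWindow G W ((S ∩ H).min' h)) K S else 0) = 0 := by
      split_ifs with h h'
      · exact absurd h'.1 hKL'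
      · exact zero_mul _
      · rfl
    rw [h2, add_zero]
    set v₀ := (K ∩ L).min' hKL with hv₀
    have hv₀mem : v₀ ∈ K ∩ L := min'_mem _ hKL
    have hv₀K : v₀ ∈ K := (mem_inter.1 hv₀mem).1
    have hv₀W : v₀ ∈ W := lowSet_subset W (mem_inter.1 hv₀mem).2
    by_cases hvS : v₀ ∈ S
    · -- (i) `v₀ ∈ S`: the sets meet
      rw [if_pos hvS, zero_mul]
      unfold disjEntry
      rw [if_neg]
      exact nonempty_iff_ne_empty.1 ⟨v₀, mem_inter.2 ⟨mem_inter.2 ⟨hv₀K, hvS⟩, hv₀W⟩⟩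
    · -- neither: continue on the neighbours of `v₀`
      rw [if_neg hvS, one_mul]
      unfold disjEntry
      rw [inter_eq_inter_nbrWindow hK hv₀K hvS]
  · -- no low clique node
    have hKL' : K ∩ L = ∅ := not_nonempty_iff_eq_empty.1 hKL
    rw [dif_neg hKL, zero_add, if_pos hKL', one_mul]
    by_cases hSH : (S ∩ H).Nonempty
    · -- the stable side announces `w₀ = min (S ∩ H)`
      have hSH' : S ∩ H ≠ ∅ := nonempty_iff_ne_empty.1 hSH
      rw [dif_pos hSH, if_neg hSH', add_zero]
      set w₀ := (S ∩ H).min' hSH with hw₀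
      have hw₀mem : w₀ ∈ S ∩ H := min'_mem _ hSH
      have hw₀S : w₀ ∈ S := (mem_inter.1 hw₀mem).1
      have hw₀W : w₀ ∈ W := highSet_subset W (mem_inter.1 hw₀mem).2
      by_cases hwK : w₀ ∈ K
      · -- (i) `w₀ ∈ K`: the sets meet
        rw [if_neg (fun h => h.2 hwK), zero_mul]
        unfold disjEntry
        rw [if_neg]
        exact nonempty_iff_ne_empty.1 ⟨w₀, mem_inter.2 ⟨mem_inter.2 ⟨hwK, hw₀S⟩, hw₀W⟩⟩
      · -- otherwise: continue on the non-neighbours of `w₀`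
        rw [if_pos ⟨hKL', hwK⟩, one_mul]
        unfold disjEntry
        rw [inter_eq_inter_coNbrWindow hS hw₀S hwK]
    · -- termination: disjoint by degrees
      have hSH' : S ∩ H = ∅ := not_nonempty_iff_eq_empty.1 hSH
      rw [dif_neg hSH, zero_add, if_pos hSH']
      unfold disjEntry
      rw [if_pos (inter_eq_empty_of_degrees hKL' hSH')]

/-! ### The rectangle count -/

/-- The bound `d(m) = (m+1)^{⌊log₂(m+1)⌋+1}` on the number of `1`-rectangles produced on a window of
`m` nodes ("there are at most `g` stages, and the communication per stage is obviously `O(g)`").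
[cite: Yannakakis1991, §5, proof of Lemma 1 (p. 463)] -/
def rectBound (m : ℕ) : ℕ := (m + 1) ^ (Nat.log 2 (m + 1) + 1)

/-- `d` is monotone. [cite: Yannakakis1991, §5, proof of Lemma 1 (p. 463)] -/
theorem rectBound_mono : Monotone rectBound := by
  intro a b hab
  unfold rectBound
  calc (a + 1) ^ (Nat.log 2 (a + 1) + 1) ≤ (b + 1) ^ (Nat.log 2 (a + 1) + 1) :=
        Nat.pow_le_pow_left (by omega) _
    _ ≤ (b + 1) ^ (Nat.log 2 (b + 1) + 1) :=
        Nat.pow_le_pow_right (by omega)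
          (by have := Nat.log_mono_right (b := 2) (show a + 1 ≤ b + 1 by omega); omega)

/-- The recurrence behind `O(g²)`: a window of `m` nodes spawns at most `m` sub-windows of
`≤ (m−1)/2` nodes each, plus one terminal rectangle: `m·d(⌊(m−1)/2⌋) + 1 ≤ d(m)`.
[cite: Yannakakis1991, §5, proof of Lemma 1 (p. 463)] -/
theorem rectBound_stage {m m' : ℕ} (hm : m' ≤ (m - 1) / 2) : m * rectBound m' + 1 ≤ rectBound m := by
  rcases Nat.eq_zero_or_pos m with rfl | hm0
  · have h0 : m' = 0 := by omega
    subst h0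
    simp [rectBound]
  · unfold rectBound
    set E := Nat.log 2 (m + 1) with hE
    have hE1 : 1 ≤ E := Nat.log_pos one_lt_two (by omega)
    have h1 : m' + 1 ≤ (m + 1) / 2 := by omega
    have h2 : Nat.log 2 (m' + 1) + 1 ≤ E := by
      have h := Nat.log_mono_right (b := 2) h1
      rw [Nat.log_div_base] at h
      omega
    have h3 : (m' + 1) ^ (Nat.log 2 (m' + 1) + 1) ≤ (m + 1) ^ E :=
      (Nat.pow_le_pow_left (by omega) _).trans (Nat.pow_le_pow_right (by omega) h2)
    have h4 : 1 ≤ (m + 1) ^ E := Nat.one_le_pow _ _ (by omega)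
    calc m * (m' + 1) ^ (Nat.log 2 (m' + 1) + 1) + 1 ≤ m * (m + 1) ^ E + (m + 1) ^ E := by
          have := Nat.mul_le_mul_left m h3
          omega
      _ = (m + 1) ^ (E + 1) := by ring

/-- An indicator is `0/1`-valued. [folklore] -/
private theorem ite_zero_or_one (p : Prop) [Decidable p] :
    (if p then (1 : ℝ) else 0) = 0 ∨ (if p then (1 : ℝ) else 0) = 1 := by
  split_ifs <;> simp

/-- A co-indicator is `0/1`-valued. [folklore] -/
private theorem ite_zero_or_one' (p : Prop) [Decidable p] :
    (if p then (0 : ℝ) else 1) = 0 ∨ (if p then (0 : ℝ) else 1) = 1 := by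
  split_ifs <;> simp

/-- Products of `0/1` values are `0/1` (a rectangle times a rectangle is a rectangle). [folklore] -/
private theorem mul_zero_or_one {x y : ℝ} (hx : x = 0 ∨ x = 1) (hy : y = 0 ∨ y = 1) :
    x * y = 0 ∨ x * y = 1 := by
  rcases hx with rfl | rfl <;> rcases hy with rfl | rfl <;> simp

/-- **The rectangle partition induced by the protocol of Lemma 1** (by strong induction on the
window): for every window `W` there are at most `(|W|+1)^{⌊log₂(|W|+1)⌋+1}` pairs of `0/1`-valued
functions `a_i` (of the clique) and `b_i` (of the stable set) with
`𝟙[K ∩ S ∩ W = ∅] = Σ_i a_i(K) b_i(S)` for all cliques `K` and stable sets `S` — the `1`-entries of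
the windowed communication matrix of `Q` are partitioned into that many monochromatic rectangles.
[cite: Yannakakis1991, §5, Lemma 1 and its proof (p. 462–463); p. 461 ("disjoint monochromatic rectangles that cover the 1's … [MS]")] -/
theorem exists_rectanglePartition (W : Finset (Fin n)) :
    ∃ (ι : Type) (_ : Fintype ι), Fintype.card ι ≤ rectBound W.card ∧
      ∃ (a b : ι → Finset (Fin n) → ℝ),
        (∀ i K, a i K = 0 ∨ a i K = 1) ∧ (∀ i S, b i S = 0 ∨ b i S = 1) ∧
        ∀ K S : Finset (Fin n), G.IsClique (K : Set (Fin n)) → (∀ i ∈ S, ∀ j ∈ S, ¬ G.Adj i j) →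
          disjEntry W K S = ∑ i, a i K * b i S := by
  suffices hmain : ∀ (m : ℕ) (W : Finset (Fin n)), W.card = m →
      ∃ (ι : Type) (_ : Fintype ι), Fintype.card ι ≤ rectBound m ∧
        ∃ (a b : ι → Finset (Fin n) → ℝ),
          (∀ i K, a i K = 0 ∨ a i K = 1) ∧ (∀ i S, b i S = 0 ∨ b i S = 1) ∧
          ∀ K S : Finset (Fin n), G.IsClique (K : Set (Fin n)) → (∀ i ∈ S, ∀ j ∈ S, ¬ G.Adj i j) →
            disjEntry W K S = ∑ i, a i K * b i S from hmain W.card W rfl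
  intro m
  refine Nat.strong_induction_on (p := fun m => ∀ W : Finset (Fin n), W.card = m →
      ∃ (ι : Type) (_ : Fintype ι), Fintype.card ι ≤ rectBound m ∧
        ∃ (a b : ι → Finset (Fin n) → ℝ),
          (∀ i K, a i K = 0 ∨ a i K = 1) ∧ (∀ i S, b i S = 0 ∨ b i S = 1) ∧
          ∀ K S : Finset (Fin n), G.IsClique (K : Set (Fin n)) → (∀ i ∈ S, ∀ j ∈ S, ¬ G.Adj i j) →
            disjEntry W K S = ∑ i, a i K * b i S) m fun m ih => ?_
  intro W hW
  set L := lowSet G W with hL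
  set H := highSet G W with hH
  have hm' : ∀ {W' : Finset (Fin n)}, W'.card ≤ (W.card - 1) / 2 → W.card ≠ 0 → W'.card < m := by
    intro W' h h0; omega
  -- the clique side's sub-windows, by induction
  have hA : ∀ v : L, ∃ (ι : Type) (_ : Fintype ι), Fintype.card ι ≤ rectBound ((m - 1) / 2) ∧
      ∃ (a b : ι → Finset (Fin n) → ℝ),
        (∀ i K, a i K = 0 ∨ a i K = 1) ∧ (∀ i S, b i S = 0 ∨ b i S = 1) ∧
        ∀ K S : Finset (Fin n), G.IsClique (K : Set (Fin n)) → (∀ i ∈ S, ∀ j ∈ S, ¬ G.Adj i j) →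
          disjEntry (nbrWindow G W v) K S = ∑ i, a i K * b i S := by
    intro v
    have hle := card_nbrWindow_le (G := G) v.2
    have hW0 : W.card ≠ 0 := card_ne_zero.2 ⟨v.1, lowSet_subset W v.2⟩
    obtain ⟨ι, hι, hcard, a, b, ha, hb, hfac⟩ := ih _ (hm' hle hW0) (nbrWindow G W v) rfl
    exact ⟨ι, hι, hcard.trans (rectBound_mono (by rw [← hW]; exact hle)), a, b, ha, hb, hfac⟩
  -- the stable side's sub-windows, by induction
  have hB : ∀ w : H, ∃ (ι : Type) (_ : Fintype ι), Fintype.card ι ≤ rectBound ((m - 1) / 2) ∧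
      ∃ (a b : ι → Finset (Fin n) → ℝ),
        (∀ i K, a i K = 0 ∨ a i K = 1) ∧ (∀ i S, b i S = 0 ∨ b i S = 1) ∧
        ∀ K S : Finset (Fin n), G.IsClique (K : Set (Fin n)) → (∀ i ∈ S, ∀ j ∈ S, ¬ G.Adj i j) →
          disjEntry (coNbrWindow G W w) K S = ∑ i, a i K * b i S := by
    intro w
    have hle := card_coNbrWindow_le (G := G) w.2
    have hW0 : W.card ≠ 0 := card_ne_zero.2 ⟨w.1, highSet_subset W w.2⟩
    obtain ⟨ι, hι, hcard, a, b, ha, hb, hfac⟩ := ih _ (hm' hle hW0) (coNbrWindow G W w) rfl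
    exact ⟨ι, hι, hcard.trans (rectBound_mono (by rw [← hW]; exact hle)), a, b, ha, hb, hfac⟩
  choose ιA fA hcA aA bA haA hbA hfA using hA
  choose ιB fB hcB aB bB haB hbB hfB using hB
  letI instA : ∀ v, Fintype (ιA v) := fA
  letI instB : ∀ w, Fintype (ιB w) := fB
  refine ⟨(Σ v : L, ιA v) ⊕ (Σ w : H, ιB w) ⊕ Unit, inferInstance, ?_, ?_⟩
  · -- the count `m·d(⌊(m−1)/2⌋) + 1 ≤ d(m)`
    rw [Fintype.card_sum, Fintype.card_sum, Fintype.card_sigma, Fintype.card_sigma, Fintype.card_unit]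
    have hLH : Fintype.card L + Fintype.card H ≤ m := by
      rw [Fintype.card_coe, Fintype.card_coe, ← card_union_of_disjoint (disjoint_lowSet_highSet W), ← hW]
      exact card_le_card (union_subset (lowSet_subset W) (highSet_subset W))
    calc ∑ v, Fintype.card (ιA v) + (∑ w, Fintype.card (ιB w) + 1)
        ≤ ∑ _v : L, rectBound ((m - 1) / 2) + (∑ _w : H, rectBound ((m - 1) / 2) + 1) := by
          gcongr with v _ w _
          · exact hcA v
          · exact hcB w
      _ = (Fintype.card L + Fintype.card H) * rectBound ((m - 1) / 2) + 1 := by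
          simp only [sum_const, card_univ, smul_eq_mul]
          ring
      _ ≤ m * rectBound ((m - 1) / 2) + 1 := by
          have := Nat.mul_le_mul_right (rectBound ((m - 1) / 2)) hLH
          omega
      _ ≤ rectBound m := rectBound_stage le_rfl
  · refine ⟨fun i K => Sum.elim
        (fun p : (Σ v : L, ιA v) =>
          (if (K ∩ L).min = ((p.1 : Fin n) : WithTop (Fin n)) then (1 : ℝ) else 0) * aA p.1 p.2 K)
        (Sum.elim
          (fun q : (Σ w : H, ιB w) =>
            (if K ∩ L = ∅ ∧ (q.1 : Fin n) ∉ K then (1 : ℝ) else 0) * aB q.1 q.2 K)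
          (fun _ => if K ∩ L = ∅ then (1 : ℝ) else 0)) i,
      fun i S => Sum.elim
        (fun p : (Σ v : L, ιA v) => (if (p.1 : Fin n) ∈ S then (0 : ℝ) else 1) * bA p.1 p.2 S)
        (Sum.elim
          (fun q : (Σ w : H, ιB w) =>
            (if (S ∩ H).min = ((q.1 : Fin n) : WithTop (Fin n)) then (1 : ℝ) else 0) * bB q.1 q.2 S)
          (fun _ => if S ∩ H = ∅ then (1 : ℝ) else 0)) i, ?_, ?_, ?_⟩
    · -- `a` is `0/1`-valued
      rintro (p | q | u) K
      · exact mul_zero_or_one (ite_zero_or_one _) (haA _ _ _)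
      · exact mul_zero_or_one (ite_zero_or_one _) (haB _ _ _)
      · exact ite_zero_or_one _
    · -- `b` is `0/1`-valued
      rintro (p | q | u) S
      · exact mul_zero_or_one (ite_zero_or_one' _) (hbA _ _ _)
      · exact mul_zero_or_one (ite_zero_or_one _) (hbB _ _ _)
      · exact ite_zero_or_one _
    · -- the factorisation: one stage, then the induction hypotheses
      intro K S hK hS
      rw [disjEntry_stage W K S hK hS, add_assoc]
      simp only [Fintype.sum_sum_type, Fintype.sum_sigma, Fintype.sum_unique, Sum.elim_inl,
        Sum.elim_inr]
      congr 1
      · rw [← sum_coe_sort L]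
        refine Finset.sum_congr rfl fun v _ => ?_
        rw [hfA v K S hK hS, mul_sum]
        exact Finset.sum_congr rfl fun j _ => by ring
      · congr 1
        rw [← sum_coe_sort H]
        refine Finset.sum_congr rfl fun w _ => ?_
        rw [hfB w K S hK hS, mul_sum]
        exact Finset.sum_congr rfl fun j _ => by ring

end CliqueStableSet

open CliqueStableSet

/-! ### Lemma 1 for the predicate `Q`, and the slack matrix of the clique constraints -/

/-- **Yannakakis 1991, Lemma 1 applied to the clique-versus-stable-set predicate `Q` of a graph `G` on
`n` nodes** (the form used for Theorem 5): the `0/1` communication matrix `𝟙[K ∩ S = ∅]` (cliques `K`,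
stable sets `S`) is a sum of at most `(n+1)^{⌊log₂(n+1)⌋+1} = n^{O(log n)}` rectangles `a_i(K)·b_i(S)`
with `a_i, b_i` `0/1`-valued — the partition of its `1`s into monochromatic rectangles induced by the
`O(log² n)`-bit deterministic protocol. [cite: Yannakakis1991, §5, Lemma 1 (p. 462) and p. 461] -/
theorem Yannakakis1991_lemma1_cliqueStableSet (G : SimpleGraph (Fin n)) [DecidableRel G.Adj] :
    ∃ (ι : Type) (_ : Fintype ι), Fintype.card ι ≤ (n + 1) ^ (Nat.log 2 (n + 1) + 1) ∧
      ∃ (a b : ι → Finset (Fin n) → ℝ),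
        (∀ i K, a i K = 0 ∨ a i K = 1) ∧ (∀ i S, b i S = 0 ∨ b i S = 1) ∧
        ∀ K S : Finset (Fin n), G.IsClique (K : Set (Fin n)) → (∀ i ∈ S, ∀ j ∈ S, ¬ G.Adj i j) →
          (if K ∩ S = ∅ then (1 : ℝ) else 0) = ∑ i, a i K * b i S := by
  obtain ⟨ι, hι, hcard, a, b, ha, hb, hfac⟩ := exists_rectanglePartition (G := G) (univ : Finset (Fin n))
  refine ⟨ι, hι, by simpa only [rectBound, card_univ, Fintype.card_fin] using hcard, a, b, ha, hb,
    fun K S hK hS => ?_⟩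
  rw [← hfac K S hK hS, disjEntry, inter_univ]

/-- "An independent set can contain at most one node from a clique." [cite: Yannakakis1991, §5 (p. 461)] -/
theorem card_inter_le_one_of_isClique {G : SimpleGraph (Fin n)} {K S : Finset (Fin n)}
    (hK : G.IsClique (K : Set (Fin n))) (hS : ∀ i ∈ S, ∀ j ∈ S, ¬ G.Adj i j) : (K ∩ S).card ≤ 1 := by
  refine card_le_one.2 fun x hx y hy => ?_
  by_contra hne
  exact hS x (mem_inter.1 hx).2 y (mem_inter.1 hy).2
    (hK (mem_coe.2 (mem_inter.1 hx).1) (mem_coe.2 (mem_inter.1 hy).1) hne)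

/-- "The slack matrix for the constraints (3) is 0-1 … the entry corresponding to a clique `K` and an
independent set `I` is `1` if `K ∩ I = ∅`, and `0` otherwise": `1 − Σ_{i∈K} 𝟙_S(i) = 𝟙[K ∩ S = ∅]`.
[cite: Yannakakis1991, §5 (p. 461)] -/
theorem cliqueSlack_eq_disjEntry {G : SimpleGraph (Fin n)} (K : Finset (Fin n))
    (hK : G.IsClique (K : Set (Fin n))) (S : StableSets G) :
    1 - ∑ i ∈ K, stableSetVector S i = if K ∩ S.1 = ∅ then (1 : ℝ) else 0 := by
  have hsum : ∑ i ∈ K, stableSetVector S i = ((K ∩ S.1).card : ℝ) := by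
    simp only [stableSetVector]
    rw [Finset.sum_boole, Finset.filter_mem_eq_inter]
  rw [hsum]
  by_cases h : K ∩ S.1 = ∅
  · simp [h]
  · have h1 : (K ∩ S.1).card = 1 :=
      le_antisymm (card_inter_le_one_of_isClique hK S.2) (card_pos.2 (nonempty_iff_ne_empty.2 h))
    simp [h, h1]

/-- **The slack matrix of the clique constraints has nonnegative rank `n^{O(log n)}`**: the matrix
`(K, S) ↦ 1 − Σ_{i∈K} 𝟙_S(i)` over cliques `K` and stable sets `S` of `G` has a nonnegative
factorisation of size `(n+1)^{⌊log₂(n+1)⌋+1}` ("a deterministic protocol … gives a linear program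
expressing VP(G) with `O(d)` variables and constraints (and 0-1 coefficients)").
[cite: Yannakakis1991, §5 (p. 461) with Lemma 1 (p. 462)] -/
theorem hasNonnegFactorization_cliqueSlack (G : SimpleGraph (Fin n)) [DecidableRel G.Adj] :
    HasNonnegFactorization
      (fun (K : {K : Finset (Fin n) // G.IsClique (K : Set (Fin n))}) (S : StableSets G) =>
        1 - ∑ i ∈ K.1, stableSetVector S i)
      ((n + 1) ^ (Nat.log 2 (n + 1) + 1)) := by
  obtain ⟨ι, hι, hcard, a, b, ha, hb, hfac⟩ := Yannakakis1991_lemma1_cliqueStableSet G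
  refine HasNonnegFactorization.mono ?_ hcard
  refine hasNonnegFactorization_of_fintype (fun K i => a i K.1) (fun i S => b i S.1)
    (fun K i => ?_) (fun i S => ?_) fun K S => ?_
  · rcases ha i K.1 with h | h <;> simp [h]
  · rcases hb i S.1 with h | h <;> simp [h]
  · rw [cliqueSlack_eq_disjEntry K.1 K.2 S]
    exact hfac K.1 S.1 K.2 S.2

/-! ### Theorem 5 -/

/-- **Yannakakis 1991, Theorem 5.** "The vertex packing polytopes of perfect graphs can be expressed
by LP's of size `n^{O(log n)}`." Typed with perfection replaced by its polyhedral characterisation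
used in the printed argument (p. 461: the clique constraints (3) "together with the nonnegativity
constraints … are sufficient to describe the vertex packing polytope of perfect graphs"), i.e. the
hypothesis `STAB(G) = QSTAB(G)` of the tree's `StableSetPolytopePsdMinimal.lean`: then `STAB(G)` has
an extended formulation of size `(n+1)^{⌊log₂(n+1)⌋+2}` (`≥ n +` the number of rectangles of Lemma 1;
the extra `n` slots serve the nonnegativity rows). Proof as printed: Lemma 1 and Yannakakis'
factorisation theorem (Thm 3, the tree's `hasEFOfSize_of_complete_nonneg_factorization`).
[cite: Yannakakis1991, Thm 5 (p. 463)] -/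
theorem Yannakakis1991_thm5 (G : SimpleGraph (Fin n)) [DecidableRel G.Adj]
    (h : stabPolytope G = cliqueConstraintPolytope G) :
    HasEFOfSize (stabPolytope G) ((n + 1) ^ (Nat.log 2 (n + 1) + 2)) := by
  classical
  obtain ⟨ι, hι, hcard, a, b, ha, hb, hfac⟩ := Yannakakis1991_lemma1_cliqueStableSet G
  -- rows: clique constraints (3) and nonnegativity; slots: the rectangles and one per coordinate
  let A : Type := {K : Finset (Fin n) // G.IsClique (K : Set (Fin n))} ⊕ Fin n
  let c : A → Fin n → ℝ :=
    Sum.elim (fun K i => if i ∈ K.1 then (1 : ℝ) else 0) (fun j i => if i = j then (-1 : ℝ) else 0)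
  let d : A → ℝ := Sum.elim (fun _ => 1) (fun _ => 0)
  let U : A → ι ⊕ Fin n → ℝ :=
    Sum.elim (fun K => Sum.elim (fun i => a i K.1) (fun _ => 0))
      (fun j => Sum.elim (fun _ => 0) (fun j' => if j' = j then (1 : ℝ) else 0))
  let Wt : StableSets G → ι ⊕ Fin n → ℝ :=
    fun S => Sum.elim (fun i => b i S.1) (fun j => stableSetVector S j)
  have hcK : ∀ (K : {K : Finset (Fin n) // G.IsClique (K : Set (Fin n))}) (x : Fin n → ℝ),
      c (Sum.inl K) ⬝ᵥ x = ∑ i ∈ K.1, x i := by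
    intro K x
    simp only [c, dotProduct, Sum.elim_inl, ite_mul, one_mul, zero_mul]
    rw [Finset.sum_ite_mem, univ_inter]
  have hcj : ∀ (j : Fin n) (x : Fin n → ℝ), c (Sum.inr j) ⬝ᵥ x = -x j := by
    intro j x
    simp only [c, dotProduct, Sum.elim_inr, ite_mul, neg_mul, one_mul, zero_mul,
      Finset.sum_ite_eq', mem_univ, if_true]
  have hcomplete : ∀ x : Fin n → ℝ, (∀ r, c r ⬝ᵥ x ≤ d r) →
      x ∈ convexHull ℝ (Set.range (stableSetVector (G := G))) := by
    intro x hx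
    have hx' : x ∈ cliqueConstraintPolytope G := by
      refine ⟨fun i => ?_, fun K hK => ?_⟩
      · have := hx (Sum.inr i)
        rw [hcj] at this
        simp only [d, Sum.elim_inr] at this
        linarith
      · have := hx (Sum.inl ⟨K, hK⟩)
        rwa [hcK] at this
    rw [← h] at hx'
    exact hx'
  have hEF := hasEFOfSize_of_complete_nonneg_factorization (ι := Fin n) (σ := ι ⊕ Fin n)
    (stableSetVector (G := G)) c d hcomplete U Wt ?_ ?_ ?_
  · have hsize : Fintype.card (ι ⊕ Fin n) ≤ (n + 1) ^ (Nat.log 2 (n + 1) + 2) := by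
      rw [Fintype.card_sum, Fintype.card_fin]
      have h1 : 1 ≤ (n + 1) ^ (Nat.log 2 (n + 1) + 1) := Nat.one_le_pow _ _ (Nat.succ_pos n)
      calc Fintype.card ι + n ≤ (n + 1) ^ (Nat.log 2 (n + 1) + 1) + n := by omega
        _ ≤ (n + 1) ^ (Nat.log 2 (n + 1) + 1) + n * (n + 1) ^ (Nat.log 2 (n + 1) + 1) := by
            have := Nat.mul_le_mul_left n h1
            omega
        _ = (n + 1) ^ (Nat.log 2 (n + 1) + 2) := by ring
    exact hEF.of_le hsize
  · -- `U ≥ 0`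
    rintro (K | j) (i | j')
    · rcases ha i K.1 with h0 | h0 <;> simp [U, h0]
    · simp [U]
    · simp [U]
    · simp only [U, Sum.elim_inr]
      split_ifs <;> norm_num
  · -- `W ≥ 0`
    rintro S (i | j)
    · rcases hb i S.1 with h0 | h0 <;> simp [Wt, h0]
    · simp only [Wt, Sum.elim_inr, stableSetVector]
      split_ifs <;> norm_num
  · -- the factorisation identities
    rintro (K | j) S
    · rw [hcK, Fintype.sum_sum_type]
      simp only [d, U, Wt, Sum.elim_inl, Sum.elim_inr, zero_mul, sum_const_zero, add_zero]
      rw [cliqueSlack_eq_disjEntry K.1 K.2 S]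
      exact hfac K.1 S.1 K.2 S.2
    · rw [hcj, Fintype.sum_sum_type]
      simp only [d, U, Wt, Sum.elim_inl, Sum.elim_inr, zero_mul, sum_const_zero, zero_add,
        ite_mul, one_mul, Finset.sum_ite_eq', mem_univ, if_true]
      ring

/-- `2^{⌊log₂(n+1)⌋} ≤ n + 1`, in the reals: `⌊log₂(n+1)⌋ · log 2 ≤ log (n+1)`. [folklore] -/
private theorem natLog_mul_log_two_le (n : ℕ) :
    (Nat.log 2 (n + 1) : ℝ) * Real.log 2 ≤ Real.log (n + 1) := by
  have h := Nat.pow_log_le_self 2 (Nat.succ_ne_zero n)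
  have h' : ((2 : ℝ) ^ Nat.log 2 (n + 1)) ≤ (n + 1 : ℝ) := by exact_mod_cast h
  have := Real.log_le_log (by positivity) h'
  rwa [Real.log_pow] at this

/-- **Theorem 5 in the `n^{O(log n)}` form**: there is `C > 0` (`C = 8/log 2`) such that for every
`n ≥ 2` and every graph `G` on `n` nodes whose stable set polytope is described by the clique and
nonnegativity constraints (perfect graphs), `STAB(G)` has an extended formulation of some size
`r ≤ n^{C·log n}`. [cite: Yannakakis1991, Thm 5 (p. 463)] -/
theorem Yannakakis1991_thm5_rpow :
    ∃ C : ℝ, 0 < C ∧ ∀ (n : ℕ), 2 ≤ n → ∀ (G : SimpleGraph (Fin n)) [DecidableRel G.Adj],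
      stabPolytope G = cliqueConstraintPolytope G →
        ∃ r : ℕ, (r : ℝ) ≤ (n : ℝ) ^ (C * Real.log n) ∧ HasEFOfSize (stabPolytope G) r := by
  refine ⟨8 / Real.log 2, by positivity, fun n hn G _ h => ⟨_, ?_, Yannakakis1991_thm5 G h⟩⟩
  have hlog2 : 0 < Real.log 2 := Real.log_pos one_lt_two
  have hn1 : (1 : ℝ) ≤ n := by exact_mod_cast (show 1 ≤ n by omega)
  have hn2 : (2 : ℝ) ≤ n := by exact_mod_cast hn
  set E := Nat.log 2 (n + 1) with hE
  -- `(n+1)^{E+2} ≤ (n²)^{E+2} = n^{2(E+2)}`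
  have hsq : ((n + 1 : ℕ) : ℝ) ≤ (n : ℝ) ^ 2 := by
    have : n + 1 ≤ n ^ 2 := by nlinarith
    exact_mod_cast this
  have h1 : (((n + 1) ^ (E + 2) : ℕ) : ℝ) ≤ (n : ℝ) ^ (2 * (E + 2)) := by
    have hsq' : (n : ℝ) + 1 ≤ (n : ℝ) ^ 2 := by exact_mod_cast hsq
    push_cast
    rw [pow_mul]
    gcongr
  -- the exponent: `2(E+2) ≤ 8 log n / log 2`
  have hElog : (E : ℝ) * Real.log 2 ≤ 2 * Real.log n := by
    have h := natLog_mul_log_two_le n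
    have h2 : Real.log (n + 1) ≤ Real.log ((n : ℝ) ^ 2) :=
      Real.log_le_log (by positivity) (by exact_mod_cast hsq)
    rw [Real.log_pow] at h2
    push_cast at h2
    linarith
  have hlogn : Real.log 2 ≤ Real.log n := Real.log_le_log two_pos hn2
  have hexp : ((2 * (E + 2) : ℕ) : ℝ) ≤ 8 / Real.log 2 * Real.log n := by
    rw [div_mul_eq_mul_div, le_div_iff₀ hlog2]
    push_cast
    nlinarith
  calc (((n + 1) ^ (E + 2) : ℕ) : ℝ) ≤ (n : ℝ) ^ (2 * (E + 2)) := h1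
    _ = (n : ℝ) ^ (((2 * (E + 2) : ℕ) : ℝ)) := (Real.rpow_natCast _ _).symm
    _ ≤ (n : ℝ) ^ (8 / Real.log 2 * Real.log n) := Real.rpow_le_rpow_of_exponent_le hn1 hexp

end Literature.Combinatorics.Optimization

/-! ## Lemma 1 in general form: the rectangle graph (appended)

p. 462, proof of Lemma 1 (verbatim): "Let `Π` be a predicate with unambiguous complexity `g`, CM be
its communication matrix, and let `D` be a set of `2^g` disjoint monochromatic rectangles that cover
the 1's of CM. Let `G` be a graph whose nodes are the rectangles of `D` and which has an edge
connecting two rectangles if they share a row of CM. For every row `r`, the rectangles that contain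
`r` form a clique `K_r`, and for every column `c`, the rectangles that contain `c` form an independent
set `I_c`, because the rectangles are disjoint, so no two of them can share both a row and a column.
Since the rectangles cover the 1's of the matrix, for any row `r` and column `c` the corresponding
entry CM(r, c) is 1 iff `K_r ∩ I_c ≠ ∅`. … this construction shows that any predicate with unambiguous
complexity `g` can be reduced to the `Q` predicate on a graph with `2^g` nodes."

Recorded, as above, at the level of rectangle partitions: if the `1`s of a `0/1` matrix `M` are
partitioned into `d` rectangles, then its `0`s are partitioned into at most `(d+1)^{⌊log₂(d+1)⌋+1}`
rectangles (`Yannakakis1991_lemma1`) — so both colour classes of `M` are partitioned into `d^{O(log d)}`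
monochromatic rectangles, the combinatorial content of "deterministic complexity `O(g²)`".
-/

namespace Literature.Combinatorics.Optimization

open CliqueStableSet

namespace CliqueStableSet

variable {X Y : Type*} {d : ℕ}

/-- **The rectangle graph** of a family of row indicators `a_i` (p. 462: "a graph whose nodes are the
rectangles of `D` and which has an edge connecting two rectangles if they share a row"): on `Fin d`,
`i ∼ j` iff `i ≠ j` and `a_i(x) = a_j(x) = 1` for some row `x`. [cite: Yannakakis1991, §5, proof of Lemma 1 (p. 462)] -/
def rectGraph (a : Fin d → X → ℝ) : SimpleGraph (Fin d) :=
  SimpleGraph.fromRel fun i j => ∃ x, a i x = 1 ∧ a j x = 1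

/-- "For every row `r`, the rectangles that contain `r` form a clique `K_r`": the rectangles through
row `x`. [cite: Yannakakis1991, §5, proof of Lemma 1 (p. 462)] -/
def rowClique (a : Fin d → X → ℝ) (x : X) : Finset (Fin d) := univ.filter fun i => a i x = 1

/-- "for every column `c`, the rectangles that contain `c` form an independent set `I_c`": the
rectangles through column `y`. [cite: Yannakakis1991, §5, proof of Lemma 1 (p. 462)] -/
def colStable (b : Fin d → Y → ℝ) (y : Y) : Finset (Fin d) := univ.filter fun i => b i y = 1

/-- `K_r` is a clique of the rectangle graph. [cite: Yannakakis1991, §5, proof of Lemma 1 (p. 462)] -/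
theorem isClique_rowClique (a : Fin d → X → ℝ) (x : X) :
    (rectGraph a).IsClique (rowClique a x : Set (Fin d)) := by
  intro i hi j hj hne
  rw [mem_coe, rowClique, mem_filter] at hi hj
  rw [rectGraph, SimpleGraph.fromRel_adj]
  exact ⟨hne, Or.inl ⟨x, hi.2, hj.2⟩⟩

/-- `I_c` is an independent set of the rectangle graph, "because the rectangles are disjoint, so no two
of them can share both a row and a column" (disjointness = the sum `Σ_i a_i(x) b_i(y)` is `0/1`-valued).
[cite: Yannakakis1991, §5, proof of Lemma 1 (p. 462)] -/
theorem colStable_stable {M : X → Y → ℝ} {a : Fin d → X → ℝ} {b : Fin d → Y → ℝ}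
    (hM : ∀ x y, M x y = 0 ∨ M x y = 1) (ha : ∀ i x, a i x = 0 ∨ a i x = 1)
    (hb : ∀ i y, b i y = 0 ∨ b i y = 1) (hfac : ∀ x y, M x y = ∑ i, a i x * b i y) (y : Y) :
    ∀ i ∈ colStable b y, ∀ j ∈ colStable b y, ¬(rectGraph a).Adj i j := by
  intro i hi j hj hadj
  rw [colStable, mem_filter] at hi hj
  rw [rectGraph, SimpleGraph.fromRel_adj] at hadj
  obtain ⟨hne, hx⟩ := hadj
  have key : ∀ {i j : Fin d}, i ≠ j → b i y = 1 → b j y = 1 → ∀ x, a i x = 1 → a j x = 1 → False := by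
    intro i j hne hbi hbj x hai haj
    have hnn : ∀ k ∈ (univ : Finset (Fin d)), 0 ≤ a k x * b k y := fun k _ => by
      rcases ha k x with h | h <;> rcases hb k y with h' | h' <;> simp [h, h']
    have h2 : a i x * b i y + a j x * b j y ≤ ∑ k, a k x * b k y := by
      have h := sum_le_sum_of_subset_of_nonneg (f := fun k => a k x * b k y)
        (subset_univ ({i, j} : Finset (Fin d))) fun k hk _ => hnn k hk
      rwa [sum_pair hne] at h
    rw [hai, hbi, haj, hbj, ← hfac] at h2
    rcases hM x y with h | h <;> rw [h] at h2 <;> norm_num at h2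
  rcases hx with ⟨x, hai, haj⟩ | ⟨x, haj, hai⟩
  · exact key hne hi.2 hj.2 x hai haj
  · exact key hne.symm hj.2 hi.2 x haj hai

/-- "Since the rectangles cover the 1's of the matrix, for any row `r` and column `c` the corresponding
entry CM(r, c) is 1 iff `K_r ∩ I_c ≠ ∅`": `M(x,y) = 1 − 𝟙[K_x ∩ I_y = ∅]`.
[cite: Yannakakis1991, §5, proof of Lemma 1 (p. 462)] -/
theorem entry_eq_one_sub_ite {M : X → Y → ℝ} {a : Fin d → X → ℝ} {b : Fin d → Y → ℝ}
    (hM : ∀ x y, M x y = 0 ∨ M x y = 1) (ha : ∀ i x, a i x = 0 ∨ a i x = 1)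
    (hb : ∀ i y, b i y = 0 ∨ b i y = 1) (hfac : ∀ x y, M x y = ∑ i, a i x * b i y) (x : X) (y : Y) :
    M x y = 1 - (if rowClique a x ∩ colStable b y = ∅ then (1 : ℝ) else 0) := by
  have hnn : ∀ k ∈ (univ : Finset (Fin d)), 0 ≤ a k x * b k y := fun k _ => by
    rcases ha k x with h | h <;> rcases hb k y with h' | h' <;> simp [h, h']
  by_cases h : rowClique a x ∩ colStable b y = ∅
  · rw [if_pos h, sub_self, hfac]
    refine sum_eq_zero fun k _ => ?_
    rcases ha k x with h0 | h1
    · rw [h0, zero_mul]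
    · rcases hb k y with h0' | h1'
      · rw [h0', mul_zero]
      · have hka : k ∈ rowClique a x := mem_filter.2 ⟨mem_univ k, h1⟩
        have hkb : k ∈ colStable b y := mem_filter.2 ⟨mem_univ k, h1'⟩
        have hk : k ∈ rowClique a x ∩ colStable b y := mem_inter.2 ⟨hka, hkb⟩
        rw [h] at hk
        exact absurd hk (notMem_empty k)
  · rw [if_neg h, sub_zero]
    obtain ⟨k, hk⟩ := nonempty_iff_ne_empty.2 h
    obtain ⟨hka, hkb⟩ := mem_inter.1 hk
    have h1 : a k x * b k y = 1 := by rw [(mem_filter.1 hka).2, (mem_filter.1 hkb).2, one_mul]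
    have hge : 1 ≤ M x y := by
      rw [hfac, ← h1]
      exact single_le_sum hnn (mem_univ k)
    rcases hM x y with h0 | h0
    · rw [h0] at hge; norm_num at hge
    · exact h0

end CliqueStableSet

/-- **Yannakakis 1991, Lemma 1** ("If the unambiguous communication complexity of a predicate is `g`,
then its deterministic complexity is at most `O(g²)`"), in rectangle-partition form: if the `1`s of a
`0/1` matrix `M` on `X × Y` are partitioned into `d` rectangles — `M = Σ_{i<d} a_i ⊗ b_i` with
`a_i, b_i` `0/1`-valued (an unambiguous protocol of complexity `log d`) — then the `0`s of `M` are
partitioned into at most `(d+1)^{⌊log₂(d+1)⌋+1}` rectangles: `1 − M = Σ_j α_j ⊗ β_j` with `α_j, β_j`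
`0/1`-valued. Proof as printed: the rectangle graph on `Fin d` (rows ↦ cliques `K_x`, columns ↦
stable sets `I_y`, `M(x,y) = 1 ⟺ K_x ∩ I_y ≠ ∅`) reduces `M` to the predicate `Q`, partitioned by
`Yannakakis1991_lemma1_cliqueStableSet`. [cite: Yannakakis1991, §5, Lemma 1 (p. 462–463)] -/
theorem Yannakakis1991_lemma1 {X Y : Type*} {d : ℕ} {M : X → Y → ℝ} {a : Fin d → X → ℝ}
    {b : Fin d → Y → ℝ} (hM : ∀ x y, M x y = 0 ∨ M x y = 1) (ha : ∀ i x, a i x = 0 ∨ a i x = 1)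
    (hb : ∀ i y, b i y = 0 ∨ b i y = 1) (hfac : ∀ x y, M x y = ∑ i, a i x * b i y) :
    ∃ (ι : Type) (_ : Fintype ι), Fintype.card ι ≤ (d + 1) ^ (Nat.log 2 (d + 1) + 1) ∧
      ∃ (α : ι → X → ℝ) (β : ι → Y → ℝ),
        (∀ j x, α j x = 0 ∨ α j x = 1) ∧ (∀ j y, β j y = 0 ∨ β j y = 1) ∧
        ∀ x y, 1 - M x y = ∑ j, α j x * β j y := by
  classical
  obtain ⟨ι, hι, hcard, α', β', hα, hβ, hfac'⟩ :=
    Yannakakis1991_lemma1_cliqueStableSet (CliqueStableSet.rectGraph a)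
  refine ⟨ι, hι, hcard, fun j x => α' j (CliqueStableSet.rowClique a x),
    fun j y => β' j (CliqueStableSet.colStable b y), fun j x => hα _ _, fun j y => hβ _ _, fun x y => ?_⟩
  have h1 := hfac' _ _ (CliqueStableSet.isClique_rowClique a x)
    (CliqueStableSet.colStable_stable hM ha hb hfac y)
  have h2 := CliqueStableSet.entry_eq_one_sub_ite hM ha hb hfac x y
  rw [h2, sub_sub_cancel]
  exact h1

end Literature.Combinatorics.Optimization
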